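import Literature.Analysis.FluidPDE.TorusEnstrophyStrainIdentity
import Literature.Geometry.Riemannian.GurskyEinsteinGapProofs
import HarnessLib

/-!
# Miller's determinant bound `-4 det S ≤ (2√6/9)|S|³` and the enstrophy bound `dℰ/dt ≤ -ν‖Δu‖₂² + (2√6/9)∫|S|³` — PROVED

Analysis/FluidPDE proof file (theorems only: no definitions, no named facts), sequel of
`TorusEnstrophyStrainIdentity.lean` (`dℰ/dt = -ν‖Δu‖₂² - 4∫det S` on `T³`).

Miller, *A regularity criterion for the Navier–Stokes equation involving only the middle
eigenvalue of the strain tensor*, Arch. Ration. Mech. Anal. 235 (2020) 99–139 = arXiv:1710.05569: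

* **Proposition 4.8 (Determinant bound).** "Let `M` be a three by three, symmetric, trace free
  matrix, then `-4 det(M) ≤ (2/9)√6 |M|³`, with equality if and only if `-½λ₁ = λ₂ = λ₃`"
  (`|M|` the Frobenius norm, `λ₁ ≤ λ₂ ≤ λ₃` the eigenvalues). Here: the inequality (the equality
  case is not formalised), for `Fin 3` and for any index type of cardinality `3`, together with
  its squared form `54 det(M)² ≤ |M|⁶` — which is the non-negativity of the discriminant
  `∏_{i<j}(λᵢ-λⱼ)² = 2((λ₁-λ₂)(2λ₁+λ₂)(λ₁+2λ₂))²` of the characteristic polynomial of `M`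
  (`λ₃ = -λ₁-λ₂`). The tree ALREADY holds this sharp algebraic inequality, in the form
  `3√6 det W ≤ |W|³` for symmetric trace-free `3 × 3` `W`, as the Gursky–LeBrun lemma of
  4-dimensional conformal geometry (`Literature.Geometry.Riemannian.GurskyLeBrun.det_le_normSq_mul_sqrt`,
  `GurskyLeBrun.det_sq_le`, file `GurskyEinsteinGapProofs.lean`, proved there through Mathlib's
  spectral theorem); Miller's form is that lemma applied to `-M` (`4/(3√6) = 2√6/9`), so this file
  imports it rather than re-proving it (gate dedup).
* **Corollary 4.9.** "`∂ₜ‖S(·,t)‖²_{L²} ≤ -2‖S‖²_{Ḣ¹} + (2/9)√6 ∫|S|³`" for mild solutions of the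
  strain equation on `ℝ³`. Here: the periodic classical form — along a classical solution of the
  unforced Navier–Stokes equations on `T^d × [a, b]`, `card d = 3`, `a < b` (any `ν`), every
  one-sided derivative `R` of the enstrophy `ℰ = ½‖∇u‖₂²` (`= ‖S‖₂²` for divergence-free fields)
  within `[a, b]` satisfies `R ≤ -ν‖Δu‖₂² + (2√6/9) ∫ |S(x)|³ dx`, `|S(x)|³ = F(x)√F(x)`,
  `F(x) = ∑ᵢⱼ Sᵢⱼ(x)²`, `Sᵢⱼ = ½((∂ⱼu)ᵢ + (∂ᵢu)ⱼ)`; from `TorusEnstrophyStrainIdentity`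
  (`dℰ/dt = -ν‖Δu‖₂² - (4/3)∫tr S³`, `tr S³ = 3 det S`) and Prop. 4.8 pointwise.
* Also the integrated stretching bound `∫ tr(GGᵀG) = 4∫det S ≥ -(2√6/9)∫|S|³` is NOT what is
  needed; the useful direction is `-∫ tr(GGᵀG) = ∫ω·Sω = -4∫det S ≤ (2√6/9)∫|S|³`
  (`neg_integral_stretching_le_strain_cube`).

These serve the functional-mining cell (pub-nsfunc): the `∫|S|³` rows (family ES / EK core
`∫|S|³`) of the dictionary are tied to the enstrophy budget by exactly this inequality, with the
printed sharp constant.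

## Mathlib / tree search

Gate dedup found the squared form `54 det² ≤ |M|⁶` already landed as
`Literature.Geometry.Riemannian.GurskyLeBrun.det_sq_le` (with `det_le_normSq_mul_sqrt`); reused.
Mathlib: `Matrix.det_neg`, `Matrix.IsSymm.neg`, `Matrix.det_reindex_self`;
tree: `DoeringGibbon1995.trace_strain_cube_eq_three_mul_det`,
`Torus.IsClassicalNSSolutionOn.hasDerivWithinAt_torusEnstrophy_strain`,
`Continuous.integrable_unitAddTorus`. `lean search 'det.*le.*sqrt 6|discriminant.*symmetric'`: nothing
relevant.

## References

* E. Miller, Arch. Ration. Mech. Anal. 235 (2020) 99–139 = arXiv:1710.05569, Prop. 4.8, Cor. 4.9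
  (held text pp. 13–14). [Miller2019]
* E. Miller, Anal. PDE 16 (2023) 997–1032, Prop. 1.9. [Miller2023StrainModel]
* M. J. Gursky, C. LeBrun, Ann. Global Anal. Geom. 17 (1999) 315–328, §3 (the algebraic
  inequality). [GurskyLebrun1999]
-/

noncomputable section

open Set MeasureTheory Finset Matrix
open scoped InnerProductSpace RealInnerProductSpace

namespace Literature.Analysis.FluidPDE

open Literature.Analysis.FunctionSpaces

namespace Miller2019

/-- **Miller's determinant bound** (Prop. 4.8): for a real symmetric trace-free `3 × 3` matrix,
`-4 det(M) ≤ (2/9)√6 |M|³`, written with `|M|³ = |M|² · √(|M|²)`, `|M|² = ∑ᵢⱼ Mᵢⱼ²`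
(equality iff the eigenvalues are `-½λ₁ = λ₂ = λ₃`; the equality case is not formalised).
Proof: the tree's Gursky–LeBrun inequality `3√6 det W ≤ |W|³` applied to `W = -M`.
[cite: Miller2019, Prop. 4.8] -/
theorem neg_four_mul_det_le (M : Matrix (Fin 3) (Fin 3) ℝ) (hsym : M.IsSymm) (htr : M.trace = 0) :
    -4 * M.det ≤ (2 / 9) * Real.sqrt 6 *
      ((∑ i, ∑ j, M i j ^ 2) * Real.sqrt (∑ i, ∑ j, M i j ^ 2)) := by
  have hsym' : (-M).IsSymm := hsym.neg
  have htr' : (-M).trace = 0 := by rw [Matrix.trace_neg, htr, neg_zero]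
  have h := Literature.Geometry.Riemannian.GurskyLeBrun.det_le_normSq_mul_sqrt (-M) hsym' htr'
  have hdet : (-M).det = -M.det := by
    rw [Matrix.det_neg, Fintype.card_fin]
    ring
  have hfro : ∑ i, ∑ j, (-M) i j ^ 2 = ∑ i, ∑ j, M i j ^ 2 := by
    simp only [Matrix.neg_apply, neg_sq]
  rw [hdet, hfro] at h
  set F : ℝ := ∑ i, ∑ j, M i j ^ 2 with hF
  have h6 : Real.sqrt 6 ^ 2 = 6 := Real.sq_sqrt (by norm_num)
  have h60 : 0 ≤ Real.sqrt 6 := Real.sqrt_nonneg 6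
  -- multiply `3√6 (-det M) ≤ F√F` by `(2/9)√6 ≥ 0`; `(2/9)√6 · 3√6 = 4`
  have h2 := mul_le_mul_of_nonneg_left h (by positivity : (0 : ℝ) ≤ (2 / 9) * Real.sqrt 6)
  have hl : (2 / 9) * Real.sqrt 6 * (3 * Real.sqrt 6 * -M.det) = -4 * M.det := by
    have : (2 / 9) * Real.sqrt 6 * (3 * Real.sqrt 6 * -M.det) =
        (2 / 3) * Real.sqrt 6 ^ 2 * -M.det := by ring
    rw [this, h6]; ring
  rw [hl] at h2
  exact h2

/-- Prop. 4.8 for any index type of cardinality `3` (reindexing to `Fin 3`; `det`, trace, symmetry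
and the Frobenius norm are invariant). [cite: Miller2019, Prop. 4.8] -/
theorem neg_four_mul_det_le_of_card {d : Type*} [Fintype d] [DecidableEq d]
    (hd : Fintype.card d = 3) (M : Matrix d d ℝ) (hsym : M.IsSymm) (htr : M.trace = 0) :
    -4 * M.det ≤ (2 / 9) * Real.sqrt 6 *
      ((∑ i, ∑ j, M i j ^ 2) * Real.sqrt (∑ i, ∑ j, M i j ^ 2)) := by
  set e : d ≃ Fin 3 := Fintype.equivFinOfCardEq hd with he
  set M3 : Matrix (Fin 3) (Fin 3) ℝ := Matrix.of fun a b => M (e.symm a) (e.symm b) with hM3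
  have hre : ∀ G : d → ℝ, ∑ i, G i = ∑ a : Fin 3, G (e.symm a) := fun G =>
    Fintype.sum_equiv e _ _ fun i => by simp
  have hdet : M.det = M3.det := by
    rw [← Matrix.det_reindex_self e M]
    rfl
  have hsym3 : M3.IsSymm := by
    refine Matrix.IsSymm.ext fun a b => ?_
    simp only [hM3, Matrix.of_apply]
    exact hsym.apply _ _
  have htr3 : M3.trace = 0 := by
    simp only [Matrix.trace, Matrix.diag, hM3, Matrix.of_apply]
    rw [← hre (fun i => M i i)]
    exact htr
  have hfro : ∑ i, ∑ j, M i j ^ 2 = ∑ a, ∑ b, M3 a b ^ 2 := by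
    simp only [hM3, Matrix.of_apply]
    simp_rw [hre]
  rw [hdet, hfro]
  exact neg_four_mul_det_le M3 hsym3 htr3

end Miller2019

variable {d : Type*} [Fintype d] [DecidableEq d]

/-- **`∫ ω·Sω = -4∫det S ≤ (2√6/9) ∫|S|³`** on `T^d`, `card d = 3`, for a smooth divergence-free
field: minus the stretching cubic `∑ₘᵢ(∂ₘu)ᵢ⟪∂ₘu, ∂ᵢu⟫ = tr(GGᵀG)` (`= 4∫det S`,
`integral_stretching_eq_four_mul_integral_det_strain`) is at most `(2√6/9) ∫ F√F`,
`F(x) = ∑ᵢⱼ Sᵢⱼ(x)²`, `Sᵢⱼ = ½((∂ⱼu)ᵢ + (∂ᵢu)ⱼ)` (Miller, Prop. 4.8 pointwise + Cor. 4.7/4.9).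
[cite: Miller2019, Prop. 4.8 and Cor. 4.9] -/
theorem neg_integral_stretching_le_strain_cube (hd : Fintype.card d = 3)
    {u : UnitAddTorus d → EuclideanSpace ℝ d} (hu : Torus.IsSmooth u) (hdiv : Torus.IsDivFree u) :
    -(∫ x, ∑ m, ∑ i, Torus.partialDeriv m u x i *
        ⟪Torus.partialDeriv m u x, Torus.partialDeriv i u x⟫_ℝ) ≤
      (2 / 9) * Real.sqrt 6 * ∫ x,
        (∑ i, ∑ j, ((Torus.partialDeriv j u x i + Torus.partialDeriv i u x j) / 2) ^ 2) *
        Real.sqrt (∑ i, ∑ j, ((Torus.partialDeriv j u x i + Torus.partialDeriv i u x j) / 2) ^ 2) := by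
  have hD : ∀ m, Torus.IsSmooth (Torus.partialDeriv m u) := fun m => hu.partialDeriv m
  have hDc : ∀ m j, Torus.IsSmooth (fun y => Torus.partialDeriv m u y j) :=
    fun m j => (hD m).apply j
  rw [integral_stretching_eq_four_mul_integral_det_strain hd hu hdiv]
  -- the strain matrix, its Frobenius square, and pointwise Prop. 4.8
  set Sd : UnitAddTorus d → Matrix d d ℝ := fun x => Matrix.of fun i j =>
    (Torus.partialDeriv j u x i + Torus.partialDeriv i u x j) / 2 with hSd
  set F : UnitAddTorus d → ℝ := fun x => ∑ i, ∑ j,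
    ((Torus.partialDeriv j u x i + Torus.partialDeriv i u x j) / 2) ^ 2 with hF
  have hpt : ∀ x, -4 * (Sd x).det ≤ (2 / 9) * Real.sqrt 6 * (F x * Real.sqrt (F x)) := by
    intro x
    have hsym : (Sd x).IsSymm := by
      refine Matrix.IsSymm.ext fun i j => ?_
      simp only [hSd, Matrix.of_apply]; ring
    have htr : (Sd x).trace = 0 := by
      simp only [Matrix.trace, Matrix.diag, hSd, Matrix.of_apply]
      have h1 : ∑ i, (Torus.partialDeriv i u x i + Torus.partialDeriv i u x i) / 2 =
          ∑ i, Torus.partialDeriv i u x i := Finset.sum_congr rfl fun i _ => by ring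
      rw [h1, ← Torus.divergence_eq_sum_partialDeriv_apply (hu.isContDiff (by simp)) x]
      exact hdiv x
    have h := Miller2019.neg_four_mul_det_le_of_card hd (Sd x) hsym htr
    simpa only [hSd, Matrix.of_apply] using h
  -- integrability
  have hFs : Torus.IsSmooth F := by
    have h : ∀ i j, Torus.IsSmooth (fun x =>
        ((Torus.partialDeriv j u x i + Torus.partialDeriv i u x j) / 2) ^ 2) :=
      fun i j => (((hDc j i).add (hDc i j)).div_const 2).pow 2
    unfold Torus.IsSmooth at h ⊢
    exact ContDiff.sum fun i _ => ContDiff.sum fun j _ => h i j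
  have hF32 : Integrable (fun x => F x * Real.sqrt (F x)) volume :=
    (hFs.continuous.mul (hFs.continuous.sqrt)).integrable_unitAddTorus
  have hdetI : Integrable (fun x => (Sd x).det) volume := by
    -- `det S = (1/3) tr S³` pointwise, and `tr S³` is smooth
    have h3 : ∀ x, (Sd x).det = (1 / 3) * ∑ i, ∑ j, ∑ k,
        ((Torus.partialDeriv j u x i + Torus.partialDeriv i u x j) / 2) *
        ((Torus.partialDeriv k u x j + Torus.partialDeriv j u x k) / 2) *
        ((Torus.partialDeriv i u x k + Torus.partialDeriv k u x i) / 2) := by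
      intro x
      set e : d ≃ Fin 3 := Fintype.equivFinOfCardEq hd with he
      set S3 : Fin 3 → Fin 3 → ℝ := fun a b => Sd x (e.symm a) (e.symm b) with hS3
      have hre : ∀ G : d → ℝ, ∑ i, G i = ∑ a : Fin 3, G (e.symm a) := fun G =>
        Fintype.sum_equiv e _ _ fun i => by simp
      have hdet : (Sd x).det = Matrix.det (Matrix.of fun a b => S3 a b) := by
        rw [← Matrix.det_reindex_self e (Sd x)]
        rfl
      have hsym : ∀ a b, S3 a b = S3 b a := by
        intro a b; simp only [hS3, hSd, Matrix.of_apply]; ring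
      have htr : ∑ a, S3 a a = 0 := by
        have h1 : ∑ a, S3 a a = ∑ m, Torus.partialDeriv m u x m := by
          simp only [hS3, hSd, Matrix.of_apply]
          rw [hre]
          exact Finset.sum_congr rfl fun a _ => by ring
        rw [h1, ← Torus.divergence_eq_sum_partialDeriv_apply (hu.isContDiff (by simp)) x]
        exact hdiv x
      have hT : (∑ i, ∑ j, ∑ k,
          ((Torus.partialDeriv j u x i + Torus.partialDeriv i u x j) / 2) *
          ((Torus.partialDeriv k u x j + Torus.partialDeriv j u x k) / 2) *
          ((Torus.partialDeriv i u x k + Torus.partialDeriv k u x i) / 2)) =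
          ∑ a, ∑ b, ∑ c, S3 a b * S3 b c * S3 c a := by
        simp only [hS3, hSd, Matrix.of_apply]
        simp_rw [hre]
      rw [hT, DoeringGibbon1995.trace_strain_cube_eq_three_mul_det S3 hsym htr, ← hdet]
      ring
    have hTs : Torus.IsSmooth (fun x => ∑ i, ∑ j, ∑ k,
        ((Torus.partialDeriv j u x i + Torus.partialDeriv i u x j) / 2) *
        ((Torus.partialDeriv k u x j + Torus.partialDeriv j u x k) / 2) *
        ((Torus.partialDeriv i u x k + Torus.partialDeriv k u x i) / 2)) := by
      have hSc : ∀ i j, Torus.IsSmooth (fun x => (Torus.partialDeriv j u x i +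
          Torus.partialDeriv i u x j) / 2) := fun i j => ((hDc j i).add (hDc i j)).div_const 2
      have h : ∀ i j k, Torus.IsSmooth (fun x =>
          ((Torus.partialDeriv j u x i + Torus.partialDeriv i u x j) / 2) *
          ((Torus.partialDeriv k u x j + Torus.partialDeriv j u x k) / 2) *
          ((Torus.partialDeriv i u x k + Torus.partialDeriv k u x i) / 2)) :=
        fun i j k => ((hSc i j).mul (hSc j k)).mul (hSc k i)
      unfold Torus.IsSmooth at h ⊢
      exact ContDiff.sum fun i _ => ContDiff.sum fun j _ => ContDiff.sum fun k _ => h i j k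
    have := (hTs.integrable.const_mul (1 / 3 : ℝ))
    exact this.congr (Filter.Eventually.of_forall fun x => (h3 x).symm)
  -- integrate
  have hmono : ∫ x, -4 * (Sd x).det ≤ ∫ x, (2 / 9) * Real.sqrt 6 * (F x * Real.sqrt (F x)) :=
    integral_mono (hdetI.const_mul _) (hF32.const_mul _) hpt
  rw [integral_const_mul, integral_const_mul] at hmono
  have hSd' : (fun x => Matrix.det (Matrix.of fun i j =>
      (Torus.partialDeriv j u x i + Torus.partialDeriv i u x j) / 2)) = fun x => (Sd x).det := rfl
  rw [hSd']
  linarith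

/-- **Enstrophy growth bound by the strain cube** (Miller, Cor. 4.9, periodic classical form):
along a classical solution of the unforced Navier–Stokes equations on `T^d × [a, b]`, `card d = 3`,
`a < b` (any `ν`, Euler included), every one-sided derivative `R` of the enstrophy
`ℰ(s) = ½‖∇u(s)‖₂²` within `[a, b]` at `t ∈ [a, b]` satisfies
`R ≤ -ν‖Δu(t)‖₂² + (2√6/9) ∫ F√F`, `F(x) = ∑ᵢⱼ Sᵢⱼ(x)² = |S(x)|²` — i.e.
`dℰ/dt ≤ -ν‖Δu‖₂² + (2√6/9)∫|S|³` (printed on `ℝ³` as `∂ₜ‖S‖²_{L²} ≤ -2‖S‖²_{Ḣ¹} + (2/9)√6∫|S|³`,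
`‖S‖₂² = ℰ`). [cite: Miller2019, Cor. 4.9] -/
theorem _root_.Literature.Analysis.FunctionSpaces.Torus.IsClassicalNSSolutionOn.enstrophyRate_le_strain_cube
    (hd : Fintype.card d = 3) {a b ν : ℝ} {u : ℝ → UnitAddTorus d → EuclideanSpace ℝ d}
    {p : ℝ → UnitAddTorus d → ℝ} (h : Torus.IsClassicalNSSolutionOn (Icc a b) ν 0 u p)
    (hab : a < b) {t : ℝ} (ht : t ∈ Icc a b) (R : ℝ)
    (hR : HasDerivWithinAt (fun s => torusEnstrophy (u s)) R (Icc a b) t) :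
    R ≤ -ν * (∫ x, ‖Torus.laplacian (u t) x‖ ^ 2) +
      (2 / 9) * Real.sqrt 6 * ∫ x,
        (∑ i, ∑ j, ((Torus.partialDeriv j (u t) x i + Torus.partialDeriv i (u t) x j) / 2) ^ 2) *
        Real.sqrt (∑ i, ∑ j,
          ((Torus.partialDeriv j (u t) x i + Torus.partialDeriv i (u t) x j) / 2) ^ 2) := by
  have hut : Torus.IsSmooth (u t) := h.smooth_velocity.isSmooth_slice ht
  have hdivt : Torus.IsDivFree (u t) := h.divFree t ht
  have hU : UniqueDiffWithinAt ℝ (Icc a b) t := uniqueDiffOn_Icc hab t ht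
  have hbal := h.hasDerivWithinAt_half_gradNormSq hab ht
  have hR' : HasDerivWithinAt (fun s => 2⁻¹ * Torus.gradNormSq (u s)) R (Icc a b) t := hR
  have hReq : R = -ν * (∫ x, ‖Torus.laplacian (u t) x‖ ^ 2) +
      ∫ x, ⟪Torus.convect (u t) (u t) x - (0 : ℝ → UnitAddTorus d → EuclideanSpace ℝ d) t x,
        Torus.laplacian (u t) x⟫_ℝ :=
    (hR'.derivWithin hU).symm.trans (hbal.derivWithin hU)
  have hconv : ∫ x, ⟪Torus.convect (u t) (u t) x - (0 : ℝ → UnitAddTorus d → EuclideanSpace ℝ d) t x,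
        Torus.laplacian (u t) x⟫_ℝ =
      ∫ x, ⟪Torus.laplacian (u t) x, Torus.convect (u t) (u t) x⟫_ℝ := by
    refine integral_congr_ae (Filter.Eventually.of_forall fun x => ?_)
    simp only [Pi.zero_apply, sub_zero]
    exact real_inner_comm _ _
  have horth := Torus.integral_inner_laplacian_convect_self_eq_neg hut hdivt
  have hle := neg_integral_stretching_le_strain_cube hd hut hdivt
  rw [hReq, hconv, horth]
  linarith

end Literature.Analysis.FluidPDE
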